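import Literature.NumberTheory.EllipticCurves.TwoVariableAnticyclotomicControl
import Literature.NumberTheory.EllipticCurves.CyclotomicZpExtensionUnramifiedAwayPProofs
import Literature.NumberTheory.GaloisRepresentations.LocalGaloisGroupProofs
import HarnessLib

/-!
# Control from the `ℤ_p²`-tower to the anticyclotomic line, LOCAL part above `𝔭`: Greenberg's
# inertia condition over `K̃_∞` forces the STRICT condition over `K_∞^{(2)}` when `M⁺`-graded
# invariants under `Gal(K̄/K̃_∞) ⊓ I_𝔭` vanish; assembly with the away-from-`p` comparison

`Proofs` file (theorems only). Sequel of `TwoVariableAnticyclotomicControl.lean` (§4 there: Castella's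
`Sel_𝔭(K_∞^{(2)}, M)` restricts INTO the Greenberg group `H¹_{nr,𝔭}(K̃_∞, M)`, strict ⟹ unramified place
by place) and of `CyclotomicZpExtensionUnramifiedAwayPProofs.lean` (away from `p` the unramified
conditions over `K_∞^{(2)}` and `K̃_∞` coincide when `κ₁` is cyclotomic). Here: the CONVERSE at the
places above `𝔭`, under a vanishing hypothesis, and the resulting description of the pull-back
`res⁻¹(H¹_{nr,𝔭}(K̃_∞, M))` by ONE-variable conditions over `K_∞^{(2)}`.

## What is proved (any number field `K`, any discrete `Γ_K`-module `M`)

* `GreenbergSelmer.inv_mul_mul_mem_inertia` — `I_v ⊴ D_v` for the tree's chosen local groups (image of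
  `absInertia ⊴ Γ_{K_v}`, `absInertia_normal_holds`).
* **`mem_strictKer_of_resOfLe_mem_greenbergKer`** — for `H ≤ H' ≤ Γ_K` with `H` normal, a local datum
  `N = M⁺_v` and the hypothesis `(N.Gr)^{H ⊓ I_v} = 0`: if `res x ∈ H¹(H, M)` satisfies Greenberg's
  INERTIA condition at `v` (its image in `H¹(H ⊓ I_v, M/M⁺)` vanishes) then `x ∈ H¹(H', M)` satisfies the
  STRICT condition (its image in `H¹(H' ⊓ D_v, M/M⁺)` vanishes). Cocycle proof: on `H' ⊓ D_v` the class
  is a cocycle `Z` which is the coboundary `∂ā` on the normal subgroup `H ⊓ I_v`; for `y ∈ H' ⊓ D_v`,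
  `t ∈ H ⊓ I_v` the identity `Z(t y) = Z(y · y⁻¹ty)` gives `t · w(y) = w(y)` for `w = Z − ∂ā`, so
  `w(y) ∈ (M/M⁺)^{H ⊓ I_v} = 0`. (Serre, *Local Fields* VII §6: inflation–restriction, injectivity of
  `H¹(G/N, A^N) = 0 → H¹(G, A) → H¹(N, A)`, written on cocycles for a non-ambient pair of groups.)
* `mem_strictKer_strictDatum_of_resOfLe_mem_greenbergKer` — the case `M⁺_𝔭 = 0` (Castella's strict datum),
  hypothesis `M^{H ⊓ I_𝔭} = 0` on `M` itself.
* **`mem_selmerOver_of_resOfLe_mem_datumSelmer`** — for `H ≤ H'` normal in `Γ_K`, Castella's data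
  `bdpData M p 𝔭` and `M^{H ⊓ I_𝔭} = 0`: a class of `H¹(H', M)` whose restriction lies in the
  Greenberg group `datumSelmer H M p (bdpData M p 𝔭) S` and which is ITSELF locally trivial away from
  `p` (off `S`) and at `∞` over `K̄^{H'}` lies in Castella's `selmerOver H' M p 𝔭 S`.
* **`resOfLe_mem_unrSelmer₂_iff_mem_datumStrictSelmer`** — for the `ℤ_p²`-tower (`κ₁` CYCLOTOMIC, any
  `κ₂`) and `M^{pairKer κ₁ κ₂ ⊓ I_v̄} = 0`: **`res a ∈ H¹_{nr,v̄}(K̃_∞, M)` iff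
  `a ∈ datumStrictSelmer (ker κ₂) M p (bdpData M p v̄) ∅`** (unramified away from `p`, STRICT at `v̄`,
  no condition above the other primes over `p` — a one-variable group over `K_∞^{(2)}`). So the pull-back
  `res⁻¹(H¹_{nr,v̄}(K̃_∞, M))` differs from Castella's `Sel_v̄(K_∞^{(2)}, M)` only by the ONE-variable
  discrepancy "unramified vs. trivial away from `p`, and at `∞`" (Castella 2018 §2.2 (eq:defs): `ℋ^ur_w`).

For `M = E[p^∞]`, `K` imaginary quadratic, `p = v v̄` split, `E/ℚ` good supersingular at `p ≥ 5`, the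
vanishing `E[p^∞]^{Gal(K̄/K̃_∞) ⊓ I_v̄} = 0` is the local input singled out on the cell bus (bsd-idea-14 g2,
2026-08-28): Serre, Invent. Math. 15 (1972) Prop. 12 (`e(K_v̄/ℚ_p) = 1` + supersingular ⇒ inertia acts on
`E[p]` through a non-split Cartan subgroup ⇒ no `p`-torsion over `ℚ_p^{ab}·ℚ_p^{nr}`); it is NOT proved
or stated as a fact here (hypothesis). Nothing about BSD or main conjectures is asserted.

References: J.-P. Serre, *Local Fields*, VII §6 (inflation–restriction); R. Greenberg, in *Algebraic
number theory* (1989), §1 p. 98 (strict vs. Greenberg condition); C. Skinner, E. Urban, Invent. Math. 195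
(2014), Prop. 3.2.8 (p. 23, local analysis at `p`); F. Castella, Camb. J. Math. 6 (2018), §2.2;
J.-P. Serre, Invent. Math. 15 (1972), Prop. 12.
-/

noncomputable section

open scoped Classical

open NumberField IsDedekindDomain Field
open Literature.NumberTheory.GaloisRepresentations Literature.NumberTheory.EllipticCurves.GreenbergSelmer
  Literature.NumberTheory.EllipticCurves.Castella2018 Literature.NumberTheory.EllipticCurves.GreenbergVatsal2000

universe u

namespace Literature.NumberTheory.EllipticCurves

/-! ## §1 `I_v ⊴ D_v` -/

namespace GreenbergSelmer

variable {K : Type u} [Field K] [NumberField K]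

/-- **`I_v` is normalised by `D_v`**: for `t ∈ I_v` and `δ ∈ D_v`, `δ⁻¹ t δ ∈ I_v` (both are images of
`Γ_{K_v}`-subgroups under `res`, and `absInertia ⊴ Γ_{K_v}`, `absInertia_normal_holds`).
[cite: NeukirchANT1999, Ch. I §9 (Def. (9.5), `I_𝔓 ⊴ G_𝔓`)] -/
theorem inv_mul_mul_mem_inertia (v : HeightOneSpectrum (𝓞 K)) {t δ : absoluteGaloisGroup K}
    (ht : t ∈ inertia v) (hδ : δ ∈ decomp v) : δ⁻¹ * t * δ ∈ inertia v := by
  obtain ⟨i, hi, rfl⟩ := Subgroup.mem_map.mp ht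
  obtain ⟨g, rfl⟩ := MonoidHom.mem_range.mp hδ
  haveI := absInertia_normal_holds (v.adicCompletion K)
  refine Subgroup.mem_map.mpr ⟨g⁻¹ * i * g, ?_, by simp only [map_mul, map_inv]⟩
  have h := Subgroup.Normal.conj_mem inferInstance i hi g⁻¹
  rwa [inv_inv] at h

end GreenbergSelmer

/-! ## §2 Greenberg's inertia condition downstairs forces the strict condition upstairs -/

section Local

variable {K : Type u} [Field K] [NumberField K]
  {M : Type u} [AddCommGroup M] [DistribMulAction (absoluteGaloisGroup K) M]
  [TopologicalSpace M] [DiscreteTopology M]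

/-- **Greenberg over `K̄^H` at `v` ⟹ STRICT over `K̄^{H'}` at `v`, when `(M/M⁺_v)^{H ⊓ I_v} = 0`.**
For `H ≤ H' ≤ Γ_K` with `H` normal and a local datum `N = M⁺_v`: if the restriction of
`x ∈ H¹(H', M)` to `H` dies in `H¹(H ⊓ I_v, M/M⁺_v)` (`N.greenbergKer H`), then `x` dies in
`H¹(H' ⊓ D_v, M/M⁺_v)` (`N.strictKer H'`). On cocycles: `Z = ∂ā` on `H ⊓ I_v ⊴ H' ⊓ D_v` forces
`Z = ∂ā` on `H' ⊓ D_v`, because `w = Z − ∂ā` satisfies `t · w(y) = w(y)` for all `t ∈ H ⊓ I_v`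
(`Z(ty) = Z(y · y⁻¹ty)`), and `(M/M⁺)^{H ⊓ I_v} = 0`. [cite: SerreLocalFields1979, VII.§6 Prop. 4]
[cite: Greenberg1989, §1 p. 98] [cite: SkinnerUrban2014, Prop. 3.2.8 (p. 23)] -/
theorem mem_strictKer_of_resOfLe_mem_greenbergKer {H H' : Subgroup (absoluteGaloisGroup K)}
    [H.Normal] (hle : H ≤ H') {v : HeightOneSpectrum (𝓞 K)} (N : LocalDatum K M v)
    (hinv : ∀ x : N.Gr, (∀ t : inertiaIn H v, t • x = x) → x = 0)
    {x : subgroupH1 H' M} (hx : resOfLe M hle x ∈ N.greenbergKer H) : x ∈ N.strictKer H' := by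
  obtain ⟨z, rfl⟩ := oneCocycleClass_surjective _ x
  rw [LocalDatum.mem_greenbergKer_iff, LocalDatum.greenbergMap, ← AddMonoidHom.comp_apply, resOfLe,
    resH1Hom_comp, CocycleCriteria.resH1Hom_oneCocycleClass_eq_zero_iff] at hx
  obtain ⟨a, ha⟩ := hx
  rw [LocalDatum.mem_strictKer_iff, LocalDatum.strictMap,
    CocycleCriteria.resH1Hom_oneCocycleClass_eq_zero_iff]
  refine ⟨a, fun y ↦ ?_⟩
  -- the cocycle on `H' ⊓ D_v` and its defect `w`
  have hZ : ∀ y y' : decompIn H' v, N.grMk (z.1 (decompInToH H' v (y * y'))) =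
      N.grMk (z.1 (decompInToH H' v y)) + y • N.grMk (z.1 (decompInToH H' v y')) := by
    intro y y'
    rw [map_mul, LayerCocycle.cocycle_mul, map_add]
    rfl
  -- elements of `H ⊓ I_v` seen in `H' ⊓ D_v`
  have hmemD : ∀ t : inertiaIn H v, (t : decomp (K := K) v) ∈ decompIn H' v := fun t ↦
    (mem_decompIn_iff H' v _).2 (hle ((mem_inertiaIn_iff H v t).1 t.2).1)
  have haD : ∀ t : inertiaIn H v,
      N.grMk (z.1 (decompInToH H' v ⟨(t : decomp (K := K) v), hmemD t⟩)) = t • a - a :=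
    fun t ↦ ha t
  set w : N.Gr := N.grMk (z.1 (decompInToH H' v y)) - (y • a - a) with hw
  suffices hw0 : w = 0 by rwa [hw, sub_eq_zero] at hw0
  refine hinv w fun t ↦ ?_
  -- `t' = y⁻¹ t y ∈ H ⊓ I_v`, and `t y = y t'`
  have ht' : ((y : decomp (K := K) v)⁻¹ * t * y : decomp (K := K) v) ∈ inertiaIn H v := by
    rw [mem_inertiaIn_iff]
    have htH := ((mem_inertiaIn_iff H v t).1 t.2)
    refine ⟨?_, ?_⟩
    · simpa only [Subgroup.coe_mul, Subgroup.coe_inv, inv_inv] using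
        Subgroup.Normal.conj_mem inferInstance _ htH.1 ((y : decomp (K := K) v) : absoluteGaloisGroup K)⁻¹
    · simpa only [Subgroup.coe_mul, Subgroup.coe_inv] using
        GreenbergSelmer.inv_mul_mul_mem_inertia v htH.2 (y : decomp (K := K) v).2
  have hprod : (⟨(t : decomp (K := K) v), hmemD t⟩ : decompIn H' v) * y =
      y * ⟨_, hmemD ⟨_, ht'⟩⟩ :=
    Subtype.ext (by simp only [Subgroup.coe_mul, mul_inv_cancel_left, mul_assoc])
  have h1 := hZ ⟨(t : decomp (K := K) v), hmemD t⟩ y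
  have h2 := hZ y ⟨_, hmemD ⟨_, ht'⟩⟩
  rw [hprod, h2, haD t, haD ⟨_, ht'⟩] at h1
  -- `h1 : Z y + y • (t' • a - a) = (t • a - a) + t • Z y`
  have hty : (y : decomp (K := K) v) * ((y : decomp (K := K) v)⁻¹ * t * y) = t * y := by
    rw [← mul_assoc, ← mul_assoc, mul_inv_cancel, one_mul]
  have e1 : y • ((⟨_, ht'⟩ : inertiaIn H v) • a) = t • ((y : decompIn H' v) • a) := by
    change (y : decomp (K := K) v) • (((y : decomp (K := K) v)⁻¹ * t * y) • a) =
      (t : decomp (K := K) v) • ((y : decomp (K := K) v) • a)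
    rw [smul_smul, smul_smul, hty]
  change (t : decomp (K := K) v) • w = w
  rw [hw, smul_sub, smul_sub]
  have h1' : N.grMk (z.1 (decompInToH H' v y)) + (y • ((⟨_, ht'⟩ : inertiaIn H v) • a) - y • a) =
      ((t : decomp (K := K) v) • a - a) + (t : decomp (K := K) v) • N.grMk (z.1 (decompInToH H' v y)) := by
    rw [← smul_sub]
    exact h1
  rw [e1] at h1'
  change N.grMk (z.1 (decompInToH H' v y)) +
      ((t : decomp (K := K) v) • ((y : decomp (K := K) v) • a) - (y : decomp (K := K) v) • a) =
    ((t : decomp (K := K) v) • a - a) + (t : decomp (K := K) v) • N.grMk (z.1 (decompInToH H' v y)) at h1'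
  change (t : decomp (K := K) v) • N.grMk (z.1 (decompInToH H' v y)) -
      ((t : decomp (K := K) v) • ((y : decomp (K := K) v) • a) - (t : decomp (K := K) v) • a) =
    N.grMk (z.1 (decompInToH H' v y)) - ((y : decomp (K := K) v) • a - a)
  rw [← sub_eq_zero]
  have := sub_eq_zero.mpr h1'
  rw [← neg_eq_zero, ← this]
  abel

/-- **The case `M⁺_𝔭 = 0` (Castella's strict datum)**, hypothesis on `M` itself: if `M^{H ⊓ I_𝔭} = 0`
and `res x` is unramified at `𝔭` over `K̄^H` (Greenberg's condition for `M⁺ = 0`), then `x` is locally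
trivial at `𝔭` over `K̄^{H'}`. [cite: SerreLocalFields1979, VII.§6 Prop. 4] [cite: Castella2018, §2.1 Def. 2.2 (arXiv:1704.06608 p. 5)] -/
theorem mem_strictKer_strictDatum_of_resOfLe_mem_greenbergKer {H H' : Subgroup (absoluteGaloisGroup K)}
    [H.Normal] (hle : H ≤ H') {v : HeightOneSpectrum (𝓞 K)}
    (hinv : ∀ m : M, (∀ t ∈ H ⊓ inertia v, t • m = m) → m = 0)
    {x : subgroupH1 H' M} (hx : resOfLe M hle x ∈ (AcSelmer.strictDatum M v).greenbergKer H) :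
    x ∈ (AcSelmer.strictDatum M v).strictKer H' := by
  refine mem_strictKer_of_resOfLe_mem_greenbergKer hle _ (fun xbar hxbar ↦ ?_) hx
  obtain ⟨m, rfl⟩ := (AcSelmer.strictDatum M v).grMk_surjective xbar
  have hm : m = 0 := by
    refine hinv m fun t ht ↦ ?_
    have htI : (⟨t, inertia_le_decomp v (Subgroup.mem_inf.mp ht).2⟩ : decomp (K := K) v) ∈ inertiaIn H v :=
      (mem_inertiaIn_iff H v _).2 (Subgroup.mem_inf.mp ht)
    have h := hxbar ⟨_, htI⟩
    change (⟨t, _⟩ : decomp (K := K) v) • (AcSelmer.strictDatum M v).grMk m = _ at h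
    rw [LocalDatum.smul_grMk, ← sub_eq_zero, ← map_sub, ← AddMonoidHom.mem_ker,
      LocalDatum.ker_grMk] at h
    have h0 : t • m - m ∈ (⊥ : AddSubgroup M) := h
    rwa [AddSubgroup.mem_bot, sub_eq_zero] at h0
  rw [hm, map_zero]

/-! ## §3 Selmer level: Castella's group over `K̄^{H'}` from the Greenberg group over `K̄^H` -/

/-- **A class over `K̄^{H'}` whose restriction is Greenberg over `K̄^H`, and which is itself locally trivial
away from `p` (off `S`) and at `∞`, lies in Castella's `Sel_𝔭^S(K̄^{H'}, M)`** — provided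
`M^{H ⊓ I_𝔭} = 0` (so that at `𝔭` Greenberg downstairs gives strict upstairs,
`mem_strictKer_strictDatum_of_resOfLe_mem_greenbergKer`; above the other primes over `p` Castella's datum
is relaxed and asks nothing). [cite: Castella2018, §2.1 Def. 2.2 (arXiv:1704.06608 p. 5)]
[cite: SkinnerUrban2014, Prop. 3.2.8 (p. 23)] -/
theorem mem_selmerOver_of_resOfLe_mem_datumSelmer {H H' : Subgroup (absoluteGaloisGroup K)}
    [H.Normal] [H'.Normal] (hle : H ≤ H') {p : ℕ} {𝔭 : HeightOneSpectrum (𝓞 K)}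
    (h𝔭 : ((p : ℕ) : 𝓞 K) ∈ 𝔭.asIdeal) {S : Set (HeightOneSpectrum (𝓞 K))}
    (hinv : ∀ m : M, (∀ t ∈ H ⊓ inertia 𝔭, t • m = m) → m = 0)
    {c : subgroupH1 H' M}
    (hres : resOfLe M hle c ∈ datumSelmer H M p (AcSelmer.bdpData M p 𝔭) S)
    (haway : ∀ (v : HeightOneSpectrum (𝓞 K)), ((p : ℕ) : 𝓞 K) ∉ v.asIdeal → v ∉ S →
      ∀ σ : absoluteGaloisGroup K, conjH1 H' M σ c ∈ awayKer H' M v)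
    (hinf : ∀ (w : InfinitePlace K) (σ : absoluteGaloisGroup K), conjH1 H' M σ c ∈ infKer H' M w) :
    c ∈ AcSelmer.selmerOver H' M p 𝔭 S := by
  rw [AcSelmer.mem_selmerOver_iff]
  refine ⟨haway, hinf, fun σ ↦ ?_⟩
  have hcomm : conjH1 H M σ (resOfLe M hle c) = resOfLe M hle (conjH1 H' M σ c) := by
    rw [← AddMonoidHom.comp_apply, ← resOfLe_comp_conjH1_holds (M := M) hle σ, AddMonoidHom.comp_apply]
  have h := ((mem_datumSelmer_iff _).mp hres).2 𝔭 h𝔭 σ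
  rw [AcSelmer.bdpData_self p 𝔭 h𝔭, hcomm] at h
  exact mem_strictKer_strictDatum_of_resOfLe_mem_greenbergKer hle hinv h

/-! ## §4 The `ℤ_p²`-tower with `κ₁` cyclotomic: `res⁻¹(H¹_{nr,v̄}(K̃_∞, M))` is a one-variable group -/

/-- **`res a ∈ H¹_{nr,v̄}(K̃_∞, M)` iff `a` is unramified away from `p` and STRICT at `v̄` over
`K_∞^{(2)}`** (`datumStrictSelmer (ker κ₂) M p (bdpData M p v̄) ∅`), for `κ₁` cyclotomic, any `κ₂`, and
`M^{Gal(K̄/K̃_∞) ⊓ I_v̄} = 0`. (⟸: strict ⟹ Greenberg and unramified ⟹ unramified under restriction,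
`resOfLe_mem_greenbergKer_of_mem_strictKer`, `resOfLe_mem_unramifiedOutside_pairKer_iff`; ⟹: §2 at `v̄`,
the relaxed datum elsewhere above `p`, and the away-from-`p` transport of
`CyclotomicZpExtensionUnramifiedAwayPProofs`.) Hence the pull-back of the two-variable Greenberg group
to `K_∞^{(2)}` exceeds Castella's `Sel_v̄(K_∞^{(2)}, M)` (trivial away from `p`, trivial at `∞`, strict
at `v̄`) exactly by the one-variable discrepancy "unramified vs. trivial at `w ∤ p`, and `∞`".
[cite: Castella2018, §2.2 (arXiv:1704.06608 p. 7)] [cite: SkinnerUrban2014, Prop. 3.2.8 (p. 23)] -/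
theorem resOfLe_mem_unrSelmer₂_iff_mem_datumStrictSelmer {p : ℕ} [Fact p.Prime]
    {κ₁ : ZpExtension K p} (hκ₁ : κ₁.IsCyclotomic) (κ₂ : ZpExtension K p)
    {vbar : HeightOneSpectrum (𝓞 K)} (hvbar : ((p : ℕ) : 𝓞 K) ∈ vbar.asIdeal)
    (hinv : ∀ m : M, (∀ t ∈ ZpExtension.pairKer κ₁ κ₂ ⊓ inertia vbar, t • m = m) → m = 0)
    (a : subgroupH1 κ₂.kerSubgroup M) :
    resOfLe M (ZpExtension.pairKer_le_right κ₁ κ₂) a ∈ unrSelmer₂ κ₁ κ₂ M vbar ↔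
      a ∈ datumStrictSelmer κ₂.kerSubgroup M p (AcSelmer.bdpData M p vbar) ∅ := by
  have hcomm : ∀ σ : absoluteGaloisGroup K, conjH1 (ZpExtension.pairKer κ₁ κ₂) M σ
      (resOfLe M (ZpExtension.pairKer_le_right κ₁ κ₂) a) =
        resOfLe M (ZpExtension.pairKer_le_right κ₁ κ₂) (conjH1 κ₂.kerSubgroup M σ a) := fun σ ↦ by
    rw [← AddMonoidHom.comp_apply, ← resOfLe_comp_conjH1_holds (M := M) _ σ, AddMonoidHom.comp_apply]
  rw [unrSelmer₂_eq, mem_datumSelmer_iff, mem_datumStrictSelmer_iff,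
    resOfLe_mem_unramifiedOutside_pairKer_iff hκ₁ κ₂ ∅ a]
  refine and_congr_right fun _ ↦ ⟨fun h v hv σ ↦ ?_, fun h v hv σ ↦ ?_⟩
  · by_cases hvv : v = vbar
    · subst hvv
      have h' := h v hv σ
      rw [AcSelmer.bdpData_self p v hv] at h' ⊢
      rw [hcomm] at h'
      exact mem_strictKer_strictDatum_of_resOfLe_mem_greenbergKer _ hinv h'
    · rw [AcSelmer.bdpData_of_ne p vbar hv hvv, AcSelmer.strictKer_relaxedDatum_eq_top]
      exact AddSubgroup.mem_top _
  · rw [hcomm]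
    exact resOfLe_mem_greenbergKer_of_mem_strictKer _ _ (h v hv σ)

end Local

end Literature.NumberTheory.EllipticCurves

end
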